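import Summits.MatrixMultiplication.OmegaCensus.STPPSmallPatternT1K9OrderLaw
import Summits.MatrixMultiplication.OmegaCensus.STPPSmallPatternEvenOrderLift
import Summits.MatrixMultiplication.OmegaCensus.STPPSmallPatternCyclicFatLifts

/-!
# ω-census, small pattern `(1,2,2)⁹`: hosts from order `116` (even orders) — the fat lifts of the `(2,1,1)⁹` order-58 law (kernel)

Cell `pub-omega`, ω construction census, seat pub-omega ENG2 (gen 36). HONEST FRAMING (verbatim): lottery ticket; floor =
certified bounds/negative ranges.  Census STRUCTURE bookkeeping (row B5, column `T2` at `k = 9`; conjecture C10 (a) LIFT-TIGHT predicts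
`onset_T2(9) = 2 · onset_T1(9)`); nothing here bears on `ω`: small patterns in small groups bound no exponent.

The `T2` column of record at `k = 9` read «every finite abelian group of order `≥ 156` hosts `(1,2,2)⁹`» (`exists_isSTPP_122pow9_of_card_ge_156`),
«odd order `≥ 157`» and the cyclic hosts `ℤ/2n`, `n ≥ 61`.  The new `T1` law `exists_isSTPP_211pow9_of_card_ge_58` and the tree's lifts give at once:

* `exists_isSTPP_122pow9_zmod_two_mul` — **`(1,2,2)⁹ ⊆ ℤ/2n` for every `n ≥ 58`** (`ℤ/116, ℤ/118, ℤ/120` are new cyclic hosts);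
* `exists_isSTPP_122pow9_of_even_card_ge_116` — **every finite abelian group of EVEN order `≥ 116` hosts `(1,2,2)⁹`** (`onset_T2(9) ≤ 116`;
  new for the even orders `116 … 154`);
* `exists_isSTPP_222pow9_of_four_dvd_card_ge_232` — every finite abelian group of order `≥ 232` divisible by `4` hosts `(2,2,2)⁹`
  (record: even order `≥ 312`; recorded for the lift chain).

Open at `k = 9` after this file: odd orders `117 … 155` other than the cyclic ray, and whether any group of order `< 116` hosts `(1,2,2)⁹`.
References: H. Cohn, R. Kleinberg, B. Szegedy, C. Umans, *Group-theoretic algorithms for matrix multiplication*, FOCS 2005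
(arXiv:math/0511460), Def. 5.1.  Seat pub-omega ENG2 (gen 36), 2026-08-29.
-/

open Literature.Computability.AlgebraicComplexity Finset

universe u

namespace Summit.MatrixMultiplication.OmegaCensus

/-- **`(1,2,2)⁹ ⊆ ℤ/2n` for every `n ≥ 58`** (fat lift of the cyclic `(2,1,1)⁹` ray from `58`). [cite: CohnKleinbergSzegedyUmans2005, Def. 5.1] -/
theorem exists_isSTPP_122pow9_zmod_two_mul (n : ℕ) (hn : 58 ≤ n) :
    ∃ A B C : Fin 9 → Finset (ZMod (2 * n)), IsSTPP A B C ∧ ∀ i, (A i).card = 1 ∧ (B i).card = 2 ∧ (C i).card = 2 :=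
  haveI : NeZero n := ⟨by omega⟩
  exists_isSTPP_122pow_zmod_two_mul_of_211pow (exists_isSTPP_211pow9_zmod_of_le58 n hn)

/-- **Every finite abelian group of even order `≥ 116` hosts `(1,2,2)⁹`** (even-order lift of the `(2,1,1)⁹` law at `58`).
[cite: CohnKleinbergSzegedyUmans2005, Def. 5.1] -/
theorem exists_isSTPP_122pow9_of_even_card_ge_116 {G : Type u} [AddCommGroup G] [Finite G] (heven : Even (Nat.card G))
    (hG : 116 ≤ Nat.card G) :
    ∃ A B C : Fin 9 → Finset G, IsSTPP A B C ∧ ∀ i, (A i).card = 1 ∧ (B i).card = 2 ∧ (C i).card = 2 :=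
  exists_isSTPP_122_of_even_card_of_law (N := 58) (fun Q _ _ hQ => exists_isSTPP_211pow9_of_card_ge_58 hQ) heven (by omega)

/-- Every finite abelian group of order `≥ 232` divisible by `4` hosts `(2,2,2)⁹` (double lift of the `(2,1,1)⁹` law at `58`).
[cite: CohnKleinbergSzegedyUmans2005, Def. 5.1] -/
theorem exists_isSTPP_222pow9_of_four_dvd_card_ge_232 {G : Type u} [AddCommGroup G] [Finite G] (h4 : 4 ∣ Nat.card G)
    (hG : 232 ≤ Nat.card G) :
    ∃ A B C : Fin 9 → Finset G, IsSTPP A B C ∧ ∀ i, (A i).card = 2 ∧ (B i).card = 2 ∧ (C i).card = 2 :=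
  exists_isSTPP_222_of_four_dvd_card_of_law (N := 58) (fun Q _ _ hQ => exists_isSTPP_211pow9_of_card_ge_58 hQ) h4 (by omega)

end Summit.MatrixMultiplication.OmegaCensus
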